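import Summits.QuantumFields.BalabanUV.Beta.GAN24.CombContactCauchyCells
import Summits.QuantumFields.BalabanUV.Beta.GAN24.ContactCauchyAssembly

/-!
# `BalabanUV.Beta.GAN24.CombContactCauchyAssembly` — row G-an2-4 ∕ (CONV-C), TRANSFER-III, (III′) S-slot (b), the Wilson contact RATE END `hCTd′`, step CT-4e part 2 AT THE
# COMB CHART: **THE (III′) WILSON CONTACT TERM, DIFFERENCED ACROSS TWO CONSECUTIVE TOP-ALIGNED CONJUGATED TOWERS IN TABLE UNITS, IS `ϑ^k`-SMALL IN SUP NORM** — from the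
# five (III′) two-tower atom ENDs (MY `CombContactRefineBHolds.exists_atomTip∕Mid∕Site_refine_three`, `CombContactRefinePThreePack.exists_pairingAtomTip∕Mid_refine_three`),
# taken here as HYPOTHESES of their exact ∃-shapes so that this file lands independently of their filing order; the (III′) twin of the OWNER gan24-p1 g22's (E)
# `ContactCauchyAssembly` §2 (its §1 [folklore] real bookkeeping `abs_comb_le ∕ abs_mul_sum_sub_le ∕ pow_pow_twelve ∕ exp_spread_le_one` reused BY NAME; part 1 =
# MY `CombContactCauchyCells.contact_eq_atoms` at `k` and `k+1`).

NOT IN PRINT; OUR BOOKKEEPING (leaf prover `b2b-balaban-gan24-formalise-leaf-01` gen 89; the OWNER's (E) text transformed BY NAME; [folklore]: the nine-group triangle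
inequality, `e^{−(κ∕12)·spread} ≤ 1`, ONE rate `ϑ = max` of the five suppliers' rates; 0 `def`, 0 cited facts, 0 `def … : Prop`, 0 sorry).  HONEST FRAMING (verbatim):
«discharging `BetaPertH` makes Bałaban's UV stability UNCONDITIONAL — a real constructive-QFT result; it is NOT the continuum limit and NOT the Clay problem.»  HONEST
DEPENDENCY (verbatim): «continuum YM on T⁴ ⇐ BetaPertH ∧ nine spine estimates (0/9 proved); BetaPertH ⇐ (D1) ∧ (D4) ∧ CAP+tail; G-an2-4 gates asym, D1 and NE2/3/4.»
**`exists_comb_contact_supRate_of_atoms`** (`d = 3`, `2 ≤ Lc`).  NO estimate of Bałaban's; CONDITIONAL on the five atom ENDs (the one-line discharge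
`CombContactCauchyAssemblyHolds` follows their landing); even discharged it is ONE of road-P2 M.104's six contact letters (`hCTd`) and discharges NOTHING of `(hS, hSall)`
of `ScombOf` by itself; 0 wall binders; NEVER «G-an2-4 closed» as (CONV-C); NOT D1, NOT BetaPertH, NOT continuum, NOT Clay.  2026-08-28; no existing file touched.
-/

noncomputable section

open Finset
open scoped BigOperators
open Literature.MathematicalPhysics.QuantumFieldTheory
open Literature.MathematicalPhysics.QuantumFieldTheory.LatticeForm (quo)
open Literature.MathematicalPhysics.QuantumFieldTheory.Balaban1983to89
open Literature.MathematicalPhysics.QuantumFieldTheory.Balaban1983to89.Beta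
open B4ContourShift (supNorm supNorm_nonneg)
open ExpKernelCalculus (Zl Zl_nonneg)
open StepJetData (wilsonA)
open AffineAveraging (Form0 Form1 Site box toSite curv curvAdj)
open AffineReproduction (contourSumAdj)
open KernelSpecInstance (wΦ)
open B6BondElimination (unitVec)
open KKTFluctuationKernel (delta1)
open BalabanCompositeJets (respStep)
open Summit.QuantumFields.BalabanUV.Beta.AxialProjectorBlockMean (bmGaugeAt)
open Summit.QuantumFields.BalabanUV.Beta.GAN24.Push4Iter (LegFam legChain)
open Summit.QuantumFields.BalabanUV.Beta.GAN24.RespStepBmDecompExact (respStepBmSeq)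
open Summit.QuantumFields.BalabanUV.Beta.GAN24.RespStepBmDecompPsi (Psi)
open Summit.QuantumFields.BalabanUV.Beta.GAN24.Push3 (push₃)
open Summit.QuantumFields.BalabanUV.Beta.SymCorrectorKernel (psiKS)
open Summit.QuantumFields.BalabanUV.Beta.GAN24.Push4 (legComp)
open Summit.QuantumFields.BalabanUV.Beta.GAN24.CombLegChainGauge (PsiFace)
open Summit.QuantumFields.BalabanUV.Beta.GAN24.ContactCauchyAssembly (abs_comb_le abs_mul_sum_sub_le pow_pow_twelve exp_spread_le_one)
open Summit.QuantumFields.BalabanUV.Beta.GAN24.CombContactCauchyCells (contact_eq_atoms)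

namespace Summit.QuantumFields.BalabanUV.Beta.GAN24.CombContactCauchyAssembly

/-! ## The (III′) contact term differenced across two conjugated towers, sup currency (`d = 3`) -/

section Three

variable {Lc : ℕ} [NeZero Lc]

/-- NOT IN PRINT; OUR BOOKKEEPING.  **(III′) CT-4e — THE (III′) WILSON CONTACT TERM DIFFERENCED ACROSS TWO CONSECUTIVE TOP-ALIGNED CONJUGATED TOWERS IS `ϑ^k`-SMALL
IN TABLE UNITS, SUP NORM** (`d = 3`, `2 ≤ Lc`), CONDITIONAL on the five (III′) two-tower atom ENDs in their exact ∃-shapes (B6 `unitVec`; every in-block pair of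
roots `r, rr`): `hTip`, `hMid`, `hSite` (MY `CombContactRefineBHolds.exists_atomTip∕Mid∕Site_refine_three`), `hPT`, `hPM` (MY
`CombContactRefinePThreePack.exists_pairingAtomTip∕Mid_refine_three`, their `AffineAveraging.unitVec` respelled by leaf-02's `affine_unitVec_eq`).  THEN
`∃ K ≥ 0, ϑ ∈ [0,1)` with, for every in-block pair of roots, every `k` and all coarse data,
`|Lc^{12(k+2)}·CT′_{k+1} − Lc^{12(k+1)}·CT′_k| ≤ K·ϑ^k`, `CT′_k = push₃ T′³ (wilsonA 3) − push₃ B³ (wilsonA 3)` at `κ′ u′ x′ z′ (inl α) (inl β)`,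
`T′ = legChain (legComp (psiKS r Lc · · (inl ·) (inl ·)) ∘ respStepBmSeq (toSite rr) Lc) 0 k` the conjugated tower, `B = respStep 1 (Lc^(k+1))`.
The OWNER gan24-p1 g22's (E) proof text, verbatim up to `T ↦ T′`, `λ ↦ λ′ = Ψ + PsiFace − bmGauge`, `∀ rr ↦ ∀ r rr`. -/
theorem exists_comb_contact_supRate_of_atoms (hLc : 2 ≤ Lc)
    (hTip : ∃ κ K ϑ : ℝ, 0 < κ ∧ 0 ≤ K ∧ 0 ≤ ϑ ∧ ϑ < 1 ∧
      ∀ (r : Fin (3 + 1) → ℕ), r ∈ box (3 + 1) Lc → ∀ (rr : Fin (3 + 1) → ℕ), rr ∈ box (3 + 1) Lc →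
        ∀ (k : ℕ) (κ' : Fin (3 + 1)) (u' : Site (3 + 1)) (α : Fin (3 + 1)) (x' : Site (3 + 1)) (β : Fin (3 + 1)) (z' : Site (3 + 1)),
          |((Lc : ℝ) ^ (k + 2)) ^ 12 *
          (∑' x : Site (3 + 1), ∑ κ,
            (Psi (toSite rr) Lc 0 (k + 1) (delta1 α x') + PsiFace r (toSite rr) Lc 0 (k + 1) (delta1 α x') - bmGaugeAt (toSite rr) (respStep (d := 3) 1 (Lc ^ (k + 2)) α x') Lc) (x + unitVec κ)
              * respStep (d := 3) 1 (Lc ^ (k + 2)) κ' u' κ x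
              * contourSumAdj (Lc ^ (k + 2)) (fun l y => wΦ (N := Lc ^ (k + 2)) (d := 3) l β (y - z')) κ x)
          - ((Lc : ℝ) ^ (k + 1)) ^ 12 *
          (∑' cc : Site (3 + 1), ∑ κ,
            (Psi (toSite rr) Lc 0 k (delta1 α x') + PsiFace r (toSite rr) Lc 0 k (delta1 α x') - bmGaugeAt (toSite rr) (respStep (d := 3) 1 (Lc ^ (k + 1)) α x') Lc) (cc + unitVec κ)
              * respStep (d := 3) 1 (Lc ^ (k + 1)) κ' u' κ cc
              * contourSumAdj (Lc ^ (k + 1)) (fun l y => wΦ (N := Lc ^ (k + 1)) (d := 3) l β (y - z')) κ cc)|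
          ≤ K * ϑ ^ k * (Zl (3 + 1) (κ / (4 * ((((3 : ℕ) : ℝ)) + 1))) * Real.exp (-(κ / 12) * (supNorm (u' - x') + supNorm (z' - x')))))
    (hMid : ∃ κ K ϑ : ℝ, 0 < κ ∧ 0 ≤ K ∧ 0 ≤ ϑ ∧ ϑ < 1 ∧
      ∀ (r : Fin (3 + 1) → ℕ), r ∈ box (3 + 1) Lc → ∀ (rr : Fin (3 + 1) → ℕ), rr ∈ box (3 + 1) Lc →
        ∀ (k : ℕ) (κ' : Fin (3 + 1)) (u' : Site (3 + 1)) (α : Fin (3 + 1)) (x' : Site (3 + 1)) (β : Fin (3 + 1)) (z' : Site (3 + 1)),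
          |((Lc : ℝ) ^ (k + 2)) ^ 12 *
          (∑' x : Site (3 + 1), ∑ κ,
            ((Psi (toSite rr) Lc 0 (k + 1) (delta1 α x') + PsiFace r (toSite rr) Lc 0 (k + 1) (delta1 α x') - bmGaugeAt (toSite rr) (respStep (d := 3) 1 (Lc ^ (k + 2)) α x') Lc) x
              + (Psi (toSite rr) Lc 0 (k + 1) (delta1 α x') + PsiFace r (toSite rr) Lc 0 (k + 1) (delta1 α x') - bmGaugeAt (toSite rr) (respStep (d := 3) 1 (Lc ^ (k + 2)) α x') Lc) (x + unitVec κ)) / 2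
              * respStep (d := 3) 1 (Lc ^ (k + 2)) κ' u' κ x
              * contourSumAdj (Lc ^ (k + 2)) (fun l y => wΦ (N := Lc ^ (k + 2)) (d := 3) l β (y - z')) κ x)
          - ((Lc : ℝ) ^ (k + 1)) ^ 12 *
          (∑' cc : Site (3 + 1), ∑ κ,
            ((Psi (toSite rr) Lc 0 k (delta1 α x') + PsiFace r (toSite rr) Lc 0 k (delta1 α x') - bmGaugeAt (toSite rr) (respStep (d := 3) 1 (Lc ^ (k + 1)) α x') Lc) cc
              + (Psi (toSite rr) Lc 0 k (delta1 α x') + PsiFace r (toSite rr) Lc 0 k (delta1 α x') - bmGaugeAt (toSite rr) (respStep (d := 3) 1 (Lc ^ (k + 1)) α x') Lc) (cc + unitVec κ)) / 2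
              * respStep (d := 3) 1 (Lc ^ (k + 1)) κ' u' κ cc
              * contourSumAdj (Lc ^ (k + 1)) (fun l y => wΦ (N := Lc ^ (k + 1)) (d := 3) l β (y - z')) κ cc)|
          ≤ K * ϑ ^ k * (Zl (3 + 1) (κ / (4 * ((((3 : ℕ) : ℝ)) + 1))) * Real.exp (-(κ / 12) * (supNorm (u' - x') + supNorm (z' - x')))))
    (hSite : ∃ κ K ϑ : ℝ, 0 < κ ∧ 0 ≤ K ∧ 0 ≤ ϑ ∧ ϑ < 1 ∧
      ∀ (r : Fin (3 + 1) → ℕ), r ∈ box (3 + 1) Lc → ∀ (rr : Fin (3 + 1) → ℕ), rr ∈ box (3 + 1) Lc →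
        ∀ (k : ℕ) (κ' : Fin (3 + 1)) (u' : Site (3 + 1)) (α : Fin (3 + 1)) (x' : Site (3 + 1)) (β : Fin (3 + 1)) (z' : Site (3 + 1)),
          |((Lc : ℝ) ^ (k + 2)) ^ 12 *
          (∑' x : Site (3 + 1), ∑ κ,
            (Psi (toSite rr) Lc 0 (k + 1) (delta1 α x') + PsiFace r (toSite rr) Lc 0 (k + 1) (delta1 α x') - bmGaugeAt (toSite rr) (respStep (d := 3) 1 (Lc ^ (k + 2)) α x') Lc) x
              * respStep (d := 3) 1 (Lc ^ (k + 2)) κ' u' κ x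
              * contourSumAdj (Lc ^ (k + 2)) (fun l y => wΦ (N := Lc ^ (k + 2)) (d := 3) l β (y - z')) κ x)
          - ((Lc : ℝ) ^ (k + 1)) ^ 12 *
          (∑' cc : Site (3 + 1), ∑ κ,
            (Psi (toSite rr) Lc 0 k (delta1 α x') + PsiFace r (toSite rr) Lc 0 k (delta1 α x') - bmGaugeAt (toSite rr) (respStep (d := 3) 1 (Lc ^ (k + 1)) α x') Lc) cc
              * respStep (d := 3) 1 (Lc ^ (k + 1)) κ' u' κ cc
              * contourSumAdj (Lc ^ (k + 1)) (fun l y => wΦ (N := Lc ^ (k + 1)) (d := 3) l β (y - z')) κ cc)|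
          ≤ K * ϑ ^ k * (Zl (3 + 1) (κ / (4 * ((((3 : ℕ) : ℝ)) + 1))) * Real.exp (-(κ / 12) * (supNorm (u' - x') + supNorm (z' - x')))))
    (hPT : ∃ κ₀ K θP : ℝ, 0 < κ₀ ∧ 0 ≤ K ∧ 0 ≤ θP ∧ θP < 1 ∧
      ∀ (r : Fin (3 + 1) → ℕ), r ∈ box (3 + 1) Lc → ∀ (rr : Fin (3 + 1) → ℕ), rr ∈ box (3 + 1) Lc →
        ∀ (k : ℕ) (μt : Fin (3 + 1)) (zt : Site (3 + 1)) (μ₁ : Fin (3 + 1)) (z₁ : Site (3 + 1)) (μ₂ : Fin (3 + 1)) (z₂ : Site (3 + 1))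
          (κ : Fin (3 + 1)),
          |(Lc : ℝ) ^ (12 * (k + 2)) * (∑' v : Site (3 + 1), contourSumAdj (Lc ^ (k + 2)) (fun κ' y => wΦ (N := Lc ^ (k + 2)) κ' μt (y - zt)) κ v
            * (Psi (toSite rr) Lc 0 (k + 1) (delta1 μ₁ z₁) (v + unitVec κ) + PsiFace r (toSite rr) Lc 0 (k + 1) (delta1 μ₁ z₁) (v + unitVec κ) - bmGaugeAt (toSite rr) (respStep (d := 3) 1 (Lc ^ (k + 2)) μ₁ z₁) Lc (v + unitVec κ))
            * ((Psi (toSite rr) Lc 0 (k + 1) (delta1 μ₂ z₂) (v + unitVec κ) + PsiFace r (toSite rr) Lc 0 (k + 1) (delta1 μ₂ z₂) (v + unitVec κ) - bmGaugeAt (toSite rr) (respStep (d := 3) 1 (Lc ^ (k + 2)) μ₂ z₂) Lc (v + unitVec κ))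
              - (Psi (toSite rr) Lc 0 (k + 1) (delta1 μ₂ z₂) v + PsiFace r (toSite rr) Lc 0 (k + 1) (delta1 μ₂ z₂) v - bmGaugeAt (toSite rr) (respStep (d := 3) 1 (Lc ^ (k + 2)) μ₂ z₂) Lc v)))
            - (Lc : ℝ) ^ (12 * (k + 1)) * (∑' w : Site (3 + 1), contourSumAdj (Lc ^ (k + 1)) (fun κ' y => wΦ (N := Lc ^ (k + 1)) κ' μt (y - zt)) κ w
            * (Psi (toSite rr) Lc 0 k (delta1 μ₁ z₁) (w + unitVec κ) + PsiFace r (toSite rr) Lc 0 k (delta1 μ₁ z₁) (w + unitVec κ) - bmGaugeAt (toSite rr) (respStep (d := 3) 1 (Lc ^ (k + 1)) μ₁ z₁) Lc (w + unitVec κ))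
            * ((Psi (toSite rr) Lc 0 k (delta1 μ₂ z₂) (w + unitVec κ) + PsiFace r (toSite rr) Lc 0 k (delta1 μ₂ z₂) (w + unitVec κ) - bmGaugeAt (toSite rr) (respStep (d := 3) 1 (Lc ^ (k + 1)) μ₂ z₂) Lc (w + unitVec κ))
              - (Psi (toSite rr) Lc 0 k (delta1 μ₂ z₂) w + PsiFace r (toSite rr) Lc 0 k (delta1 μ₂ z₂) w - bmGaugeAt (toSite rr) (respStep (d := 3) 1 (Lc ^ (k + 1)) μ₂ z₂) Lc w)))|
            ≤ K * θP ^ k * Real.exp (-(κ₀ / 12) * (supNorm (z₁ - zt) + supNorm (z₂ - zt))))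
    (hPM : ∃ κ₀ K θP : ℝ, 0 < κ₀ ∧ 0 ≤ K ∧ 0 ≤ θP ∧ θP < 1 ∧
      ∀ (r : Fin (3 + 1) → ℕ), r ∈ box (3 + 1) Lc → ∀ (rr : Fin (3 + 1) → ℕ), rr ∈ box (3 + 1) Lc →
        ∀ (k : ℕ) (μt : Fin (3 + 1)) (zt : Site (3 + 1)) (μ₁ : Fin (3 + 1)) (z₁ : Site (3 + 1)) (μ₂ : Fin (3 + 1)) (z₂ : Site (3 + 1))
          (κ : Fin (3 + 1)),
          |(Lc : ℝ) ^ (12 * (k + 2)) * (∑' v : Site (3 + 1), contourSumAdj (Lc ^ (k + 2)) (fun κ' y => wΦ (N := Lc ^ (k + 2)) κ' μt (y - zt)) κ v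
            * (((Psi (toSite rr) Lc 0 (k + 1) (delta1 μ₁ z₁) v + PsiFace r (toSite rr) Lc 0 (k + 1) (delta1 μ₁ z₁) v - bmGaugeAt (toSite rr) (respStep (d := 3) 1 (Lc ^ (k + 2)) μ₁ z₁) Lc v)
              + (Psi (toSite rr) Lc 0 (k + 1) (delta1 μ₁ z₁) (v + unitVec κ) + PsiFace r (toSite rr) Lc 0 (k + 1) (delta1 μ₁ z₁) (v + unitVec κ) - bmGaugeAt (toSite rr) (respStep (d := 3) 1 (Lc ^ (k + 2)) μ₁ z₁) Lc (v + unitVec κ))) / 2)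
            * ((Psi (toSite rr) Lc 0 (k + 1) (delta1 μ₂ z₂) (v + unitVec κ) + PsiFace r (toSite rr) Lc 0 (k + 1) (delta1 μ₂ z₂) (v + unitVec κ) - bmGaugeAt (toSite rr) (respStep (d := 3) 1 (Lc ^ (k + 2)) μ₂ z₂) Lc (v + unitVec κ))
              - (Psi (toSite rr) Lc 0 (k + 1) (delta1 μ₂ z₂) v + PsiFace r (toSite rr) Lc 0 (k + 1) (delta1 μ₂ z₂) v - bmGaugeAt (toSite rr) (respStep (d := 3) 1 (Lc ^ (k + 2)) μ₂ z₂) Lc v)))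
            - (Lc : ℝ) ^ (12 * (k + 1)) * (∑' w : Site (3 + 1), contourSumAdj (Lc ^ (k + 1)) (fun κ' y => wΦ (N := Lc ^ (k + 1)) κ' μt (y - zt)) κ w
            * (((Psi (toSite rr) Lc 0 k (delta1 μ₁ z₁) w + PsiFace r (toSite rr) Lc 0 k (delta1 μ₁ z₁) w - bmGaugeAt (toSite rr) (respStep (d := 3) 1 (Lc ^ (k + 1)) μ₁ z₁) Lc w)
              + (Psi (toSite rr) Lc 0 k (delta1 μ₁ z₁) (w + unitVec κ) + PsiFace r (toSite rr) Lc 0 k (delta1 μ₁ z₁) (w + unitVec κ) - bmGaugeAt (toSite rr) (respStep (d := 3) 1 (Lc ^ (k + 1)) μ₁ z₁) Lc (w + unitVec κ))) / 2)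
            * ((Psi (toSite rr) Lc 0 k (delta1 μ₂ z₂) (w + unitVec κ) + PsiFace r (toSite rr) Lc 0 k (delta1 μ₂ z₂) (w + unitVec κ) - bmGaugeAt (toSite rr) (respStep (d := 3) 1 (Lc ^ (k + 1)) μ₂ z₂) Lc (w + unitVec κ))
              - (Psi (toSite rr) Lc 0 k (delta1 μ₂ z₂) w + PsiFace r (toSite rr) Lc 0 k (delta1 μ₂ z₂) w - bmGaugeAt (toSite rr) (respStep (d := 3) 1 (Lc ^ (k + 1)) μ₂ z₂) Lc w)))|
            ≤ K * θP ^ k * Real.exp (-(κ₀ / 12) * (supNorm (z₁ - zt) + supNorm (z₂ - zt)))) :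
    ∃ K ϑ : ℝ, 0 ≤ K ∧ 0 ≤ ϑ ∧ ϑ < 1 ∧ ∀ (r : Fin (3 + 1) → ℕ), r ∈ box (3 + 1) Lc → ∀ (rr : Fin (3 + 1) → ℕ), rr ∈ box (3 + 1) Lc →
      ∀ (k : ℕ) (κ₁ : Fin (3 + 1)) (u' x' z' : Site (3 + 1)) (α β : Fin (3 + 1)),
        |(Lc : ℝ) ^ (12 * (k + 2)) *
            (push₃ (legChain (fun j => legComp (fun α x κ u => psiKS r Lc u x (Sum.inl κ) (Sum.inl α)) (respStepBmSeq (d := 3) (toSite rr) Lc j)) 0 (k + 1)) (legChain (fun j => legComp (fun α x κ u => psiKS r Lc u x (Sum.inl κ) (Sum.inl α)) (respStepBmSeq (d := 3) (toSite rr) Lc j)) 0 (k + 1))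
                (legChain (fun j => legComp (fun α x κ u => psiKS r Lc u x (Sum.inl κ) (Sum.inl α)) (respStepBmSeq (d := 3) (toSite rr) Lc j)) 0 (k + 1)) (wilsonA 3) κ₁ u' x' z' (Sum.inl α) (Sum.inl β)
              - push₃ (respStep (d := 3) 1 (Lc ^ (k + 2))) (respStep (d := 3) 1 (Lc ^ (k + 2))) (respStep (d := 3) 1 (Lc ^ (k + 2)))
                (wilsonA 3) κ₁ u' x' z' (Sum.inl α) (Sum.inl β))
          - (Lc : ℝ) ^ (12 * (k + 1)) *
            (push₃ (legChain (fun j => legComp (fun α x κ u => psiKS r Lc u x (Sum.inl κ) (Sum.inl α)) (respStepBmSeq (d := 3) (toSite rr) Lc j)) 0 k) (legChain (fun j => legComp (fun α x κ u => psiKS r Lc u x (Sum.inl κ) (Sum.inl α)) (respStepBmSeq (d := 3) (toSite rr) Lc j)) 0 k)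
                (legChain (fun j => legComp (fun α x κ u => psiKS r Lc u x (Sum.inl κ) (Sum.inl α)) (respStepBmSeq (d := 3) (toSite rr) Lc j)) 0 k) (wilsonA 3) κ₁ u' x' z' (Sum.inl α) (Sum.inl β)
              - push₃ (respStep (d := 3) 1 (Lc ^ (k + 1))) (respStep (d := 3) 1 (Lc ^ (k + 1))) (respStep (d := 3) 1 (Lc ^ (k + 1)))
                (wilsonA 3) κ₁ u' x' z' (Sum.inl α) (Sum.inl β))|
          ≤ K * ϑ ^ k := by
  obtain ⟨κ₁, K₁, ϑ₁, hκ₁, hK₁, hϑ₁0, hϑ₁1, hT⟩ := hTip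
  obtain ⟨κ₂, K₂, ϑ₂, hκ₂, hK₂, hϑ₂0, hϑ₂1, hM⟩ := hMid
  obtain ⟨κ₃, K₃, ϑ₃, hκ₃, hK₃, hϑ₃0, hϑ₃1, hS⟩ := hSite
  obtain ⟨κ₄, K₄, ϑ₄, hκ₄, hK₄, hϑ₄0, hϑ₄1, hPt⟩ := hPT
  obtain ⟨κ₅, K₅, ϑ₅, hκ₅, hK₅, hϑ₅0, hϑ₅1, hPm⟩ := hPM
  -- one rate
  set ϑ : ℝ := max (max (max ϑ₁ ϑ₂) (max ϑ₃ ϑ₄)) ϑ₅ with hϑ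
  have h1 : ϑ₁ ≤ ϑ := ((le_max_left _ _).trans (le_max_left _ _)).trans (le_max_left _ _)
  have h2 : ϑ₂ ≤ ϑ := ((le_max_right _ _).trans (le_max_left _ _)).trans (le_max_left _ _)
  have h3 : ϑ₃ ≤ ϑ := ((le_max_left _ _).trans (le_max_right _ _)).trans (le_max_left _ _)
  have h4 : ϑ₄ ≤ ϑ := ((le_max_right _ _).trans (le_max_right _ _)).trans (le_max_left _ _)
  have h5 : ϑ₅ ≤ ϑ := le_max_right _ _
  have hϑ0 : 0 ≤ ϑ := hϑ₅0.trans h5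
  have hϑ1 : ϑ < 1 := max_lt (max_lt (max_lt hϑ₁1 hϑ₂1) (max_lt hϑ₃1 hϑ₄1)) hϑ₅1
  -- the envelope constants
  set Z₁ : ℝ := Zl (3 + 1) (κ₁ / (4 * ((((3 : ℕ) : ℝ)) + 1))) with hZ₁
  set Z₂ : ℝ := Zl (3 + 1) (κ₂ / (4 * ((((3 : ℕ) : ℝ)) + 1))) with hZ₂
  set Z₃ : ℝ := Zl (3 + 1) (κ₃ / (4 * ((((3 : ℕ) : ℝ)) + 1))) with hZ₃
  have hZ₁0 : 0 ≤ Z₁ := Zl_nonneg (by positivity)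
  have hZ₂0 : 0 ≤ Z₂ := Zl_nonneg (by positivity)
  have hZ₃0 : 0 ≤ Z₃ := Zl_nonneg (by positivity)
  set K : ℝ := (1 / 2 : ℝ) * (K₁ * Z₁ + 4 * K₄ + K₂ * Z₂ + 4 * K₅ + K₁ * Z₁ + 4 * K₄ + K₂ * Z₂ + K₃ * Z₃ + K₃ * Z₃) with hK
  refine ⟨K, ϑ, by positivity, hϑ0, hϑ1, fun r hr rr hrr k κ₁' u' x' z' α β => ?_⟩
  -- the geometric step of each supplier against the common rate, envelopes bounded by one
  have geo : ∀ {θ K' Z E : ℝ}, 0 ≤ θ → θ ≤ ϑ → 0 ≤ K' → 0 ≤ Z → E ≤ 1 → 0 ≤ E → K' * θ ^ k * (Z * E) ≤ K' * Z * ϑ ^ k := by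
    intro θ K' Z E hθ0 hθ hK' hZ hE hE0
    have hp : θ ^ k ≤ ϑ ^ k := pow_le_pow_left₀ hθ0 hθ k
    have hp0 : 0 ≤ θ ^ k := pow_nonneg hθ0 k
    calc K' * θ ^ k * (Z * E) ≤ K' * θ ^ k * (Z * 1) := by gcongr
      _ = K' * Z * θ ^ k := by ring
      _ ≤ K' * Z * ϑ ^ k := mul_le_mul_of_nonneg_left hp (mul_nonneg hK' hZ)
  have geoP : ∀ {θ K' E : ℝ}, 0 ≤ θ → θ ≤ ϑ → 0 ≤ K' → E ≤ 1 → 0 ≤ E → K' * θ ^ k * E ≤ K' * ϑ ^ k := by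
    intro θ K' E hθ0 hθ hK' hE hE0
    have hp : θ ^ k ≤ ϑ ^ k := pow_le_pow_left₀ hθ0 hθ k
    have hp0 : 0 ≤ θ ^ k := pow_nonneg hθ0 k
    calc K' * θ ^ k * E ≤ K' * θ ^ k * 1 := by gcongr
      _ = K' * θ ^ k := by ring
      _ ≤ K' * ϑ ^ k := mul_le_mul_of_nonneg_left hp hK'
  -- the B-atom letters in our currency
  have bT : ∀ (κ' : Fin (3 + 1)) (u' : Site (3 + 1)) (α : Fin (3 + 1)) (x' : Site (3 + 1)) (β : Fin (3 + 1)) (z' : Site (3 + 1)),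
      |(Lc : ℝ) ^ (12 * (k + 2)) *
          (∑' x : Site (3 + 1), ∑ κ,
            (Psi (toSite rr) Lc 0 (k + 1) (delta1 α x') + PsiFace r (toSite rr) Lc 0 (k + 1) (delta1 α x') - bmGaugeAt (toSite rr) (respStep (d := 3) 1 (Lc ^ (k + 2)) α x') Lc) (x + unitVec κ)
              * respStep (d := 3) 1 (Lc ^ (k + 2)) κ' u' κ x
              * contourSumAdj (Lc ^ (k + 2)) (fun l y => wΦ (N := Lc ^ (k + 2)) (d := 3) l β (y - z')) κ x)
          - (Lc : ℝ) ^ (12 * (k + 1)) *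
          (∑' cc : Site (3 + 1), ∑ κ,
            (Psi (toSite rr) Lc 0 k (delta1 α x') + PsiFace r (toSite rr) Lc 0 k (delta1 α x') - bmGaugeAt (toSite rr) (respStep (d := 3) 1 (Lc ^ (k + 1)) α x') Lc) (cc + unitVec κ)
              * respStep (d := 3) 1 (Lc ^ (k + 1)) κ' u' κ cc
              * contourSumAdj (Lc ^ (k + 1)) (fun l y => wΦ (N := Lc ^ (k + 1)) (d := 3) l β (y - z')) κ cc)|
        ≤ K₁ * Z₁ * ϑ ^ k := by
    intro κ' u' α x' β z'
    have h := hT r hr rr hrr k κ' u' α x' β z'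
    rw [pow_pow_twelve, pow_pow_twelve] at h
    exact h.trans (geo hϑ₁0 h1 hK₁ hZ₁0 (exp_spread_le_one hκ₁.le _ _) (Real.exp_pos _).le)
  have bM : ∀ (κ' : Fin (3 + 1)) (u' : Site (3 + 1)) (α : Fin (3 + 1)) (x' : Site (3 + 1)) (β : Fin (3 + 1)) (z' : Site (3 + 1)),
      |(Lc : ℝ) ^ (12 * (k + 2)) *
          (∑' x : Site (3 + 1), ∑ κ,
            ((Psi (toSite rr) Lc 0 (k + 1) (delta1 α x') + PsiFace r (toSite rr) Lc 0 (k + 1) (delta1 α x') - bmGaugeAt (toSite rr) (respStep (d := 3) 1 (Lc ^ (k + 2)) α x') Lc) x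
              + (Psi (toSite rr) Lc 0 (k + 1) (delta1 α x') + PsiFace r (toSite rr) Lc 0 (k + 1) (delta1 α x') - bmGaugeAt (toSite rr) (respStep (d := 3) 1 (Lc ^ (k + 2)) α x') Lc) (x + unitVec κ)) / 2
              * respStep (d := 3) 1 (Lc ^ (k + 2)) κ' u' κ x
              * contourSumAdj (Lc ^ (k + 2)) (fun l y => wΦ (N := Lc ^ (k + 2)) (d := 3) l β (y - z')) κ x)
          - (Lc : ℝ) ^ (12 * (k + 1)) *
          (∑' cc : Site (3 + 1), ∑ κ,
            ((Psi (toSite rr) Lc 0 k (delta1 α x') + PsiFace r (toSite rr) Lc 0 k (delta1 α x') - bmGaugeAt (toSite rr) (respStep (d := 3) 1 (Lc ^ (k + 1)) α x') Lc) cc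
              + (Psi (toSite rr) Lc 0 k (delta1 α x') + PsiFace r (toSite rr) Lc 0 k (delta1 α x') - bmGaugeAt (toSite rr) (respStep (d := 3) 1 (Lc ^ (k + 1)) α x') Lc) (cc + unitVec κ)) / 2
              * respStep (d := 3) 1 (Lc ^ (k + 1)) κ' u' κ cc
              * contourSumAdj (Lc ^ (k + 1)) (fun l y => wΦ (N := Lc ^ (k + 1)) (d := 3) l β (y - z')) κ cc)|
        ≤ K₂ * Z₂ * ϑ ^ k := by
    intro κ' u' α x' β z'
    have h := hM r hr rr hrr k κ' u' α x' β z'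
    rw [pow_pow_twelve, pow_pow_twelve] at h
    exact h.trans (geo hϑ₂0 h2 hK₂ hZ₂0 (exp_spread_le_one hκ₂.le _ _) (Real.exp_pos _).le)
  have bS : ∀ (κ' : Fin (3 + 1)) (u' : Site (3 + 1)) (α : Fin (3 + 1)) (x' : Site (3 + 1)) (β : Fin (3 + 1)) (z' : Site (3 + 1)),
      |(Lc : ℝ) ^ (12 * (k + 2)) *
          (∑' x : Site (3 + 1), ∑ κ,
            (Psi (toSite rr) Lc 0 (k + 1) (delta1 α x') + PsiFace r (toSite rr) Lc 0 (k + 1) (delta1 α x') - bmGaugeAt (toSite rr) (respStep (d := 3) 1 (Lc ^ (k + 2)) α x') Lc) x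
              * respStep (d := 3) 1 (Lc ^ (k + 2)) κ' u' κ x
              * contourSumAdj (Lc ^ (k + 2)) (fun l y => wΦ (N := Lc ^ (k + 2)) (d := 3) l β (y - z')) κ x)
          - (Lc : ℝ) ^ (12 * (k + 1)) *
          (∑' cc : Site (3 + 1), ∑ κ,
            (Psi (toSite rr) Lc 0 k (delta1 α x') + PsiFace r (toSite rr) Lc 0 k (delta1 α x') - bmGaugeAt (toSite rr) (respStep (d := 3) 1 (Lc ^ (k + 1)) α x') Lc) cc
              * respStep (d := 3) 1 (Lc ^ (k + 1)) κ' u' κ cc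
              * contourSumAdj (Lc ^ (k + 1)) (fun l y => wΦ (N := Lc ^ (k + 1)) (d := 3) l β (y - z')) κ cc)|
        ≤ K₃ * Z₃ * ϑ ^ k := by
    intro κ' u' α x' β z'
    have h := hS r hr rr hrr k κ' u' α x' β z'
    rw [pow_pow_twelve, pow_pow_twelve] at h
    exact h.trans (geo hϑ₃0 h3 hK₃ hZ₃0 (exp_spread_le_one hκ₃.le _ _) (Real.exp_pos _).le)
  -- the P-atom letters, summed over the direction
  have card4 : (((Finset.univ : Finset (Fin (3 + 1))).card : ℕ) : ℝ) = 4 := by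
    rw [Finset.card_univ, Fintype.card_fin]; norm_num
  have bPt : ∀ (μt : Fin (3 + 1)) (zt : Site (3 + 1)) (μ₁ : Fin (3 + 1)) (z₁ : Site (3 + 1)) (μ₂ : Fin (3 + 1)) (z₂ : Site (3 + 1)),
      |(Lc : ℝ) ^ (12 * (k + 2)) * (∑ κ : Fin (3 + 1), ∑' v : Site (3 + 1),
            contourSumAdj (Lc ^ (k + 2)) (fun κ' y => wΦ (N := Lc ^ (k + 2)) κ' μt (y - zt)) κ v
            * (Psi (toSite rr) Lc 0 (k + 1) (delta1 μ₁ z₁) (v + unitVec κ) + PsiFace r (toSite rr) Lc 0 (k + 1) (delta1 μ₁ z₁) (v + unitVec κ) - bmGaugeAt (toSite rr) (respStep (d := 3) 1 (Lc ^ (k + 2)) μ₁ z₁) Lc (v + unitVec κ))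
            * ((Psi (toSite rr) Lc 0 (k + 1) (delta1 μ₂ z₂) (v + unitVec κ) + PsiFace r (toSite rr) Lc 0 (k + 1) (delta1 μ₂ z₂) (v + unitVec κ) - bmGaugeAt (toSite rr) (respStep (d := 3) 1 (Lc ^ (k + 2)) μ₂ z₂) Lc (v + unitVec κ))
              - (Psi (toSite rr) Lc 0 (k + 1) (delta1 μ₂ z₂) v + PsiFace r (toSite rr) Lc 0 (k + 1) (delta1 μ₂ z₂) v - bmGaugeAt (toSite rr) (respStep (d := 3) 1 (Lc ^ (k + 2)) μ₂ z₂) Lc v)))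
          - (Lc : ℝ) ^ (12 * (k + 1)) * (∑ κ : Fin (3 + 1), ∑' w : Site (3 + 1),
            contourSumAdj (Lc ^ (k + 1)) (fun κ' y => wΦ (N := Lc ^ (k + 1)) κ' μt (y - zt)) κ w
            * (Psi (toSite rr) Lc 0 k (delta1 μ₁ z₁) (w + unitVec κ) + PsiFace r (toSite rr) Lc 0 k (delta1 μ₁ z₁) (w + unitVec κ) - bmGaugeAt (toSite rr) (respStep (d := 3) 1 (Lc ^ (k + 1)) μ₁ z₁) Lc (w + unitVec κ))
            * ((Psi (toSite rr) Lc 0 k (delta1 μ₂ z₂) (w + unitVec κ) + PsiFace r (toSite rr) Lc 0 k (delta1 μ₂ z₂) (w + unitVec κ) - bmGaugeAt (toSite rr) (respStep (d := 3) 1 (Lc ^ (k + 1)) μ₂ z₂) Lc (w + unitVec κ))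
              - (Psi (toSite rr) Lc 0 k (delta1 μ₂ z₂) w + PsiFace r (toSite rr) Lc 0 k (delta1 μ₂ z₂) w - bmGaugeAt (toSite rr) (respStep (d := 3) 1 (Lc ^ (k + 1)) μ₂ z₂) Lc w)))|
        ≤ 4 * K₄ * ϑ ^ k := by
    intro μt zt μ₁ z₁ μ₂ z₂
    have h := abs_mul_sum_sub_le (Finset.univ : Finset (Fin (3 + 1))) ((Lc : ℝ) ^ (12 * (k + 1))) ((Lc : ℝ) ^ (12 * (k + 2)))
      (fun κ => ∑' w : Site (3 + 1),
            contourSumAdj (Lc ^ (k + 1)) (fun κ' y => wΦ (N := Lc ^ (k + 1)) κ' μt (y - zt)) κ w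
            * (Psi (toSite rr) Lc 0 k (delta1 μ₁ z₁) (w + unitVec κ) + PsiFace r (toSite rr) Lc 0 k (delta1 μ₁ z₁) (w + unitVec κ) - bmGaugeAt (toSite rr) (respStep (d := 3) 1 (Lc ^ (k + 1)) μ₁ z₁) Lc (w + unitVec κ))
            * ((Psi (toSite rr) Lc 0 k (delta1 μ₂ z₂) (w + unitVec κ) + PsiFace r (toSite rr) Lc 0 k (delta1 μ₂ z₂) (w + unitVec κ) - bmGaugeAt (toSite rr) (respStep (d := 3) 1 (Lc ^ (k + 1)) μ₂ z₂) Lc (w + unitVec κ))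
              - (Psi (toSite rr) Lc 0 k (delta1 μ₂ z₂) w + PsiFace r (toSite rr) Lc 0 k (delta1 μ₂ z₂) w - bmGaugeAt (toSite rr) (respStep (d := 3) 1 (Lc ^ (k + 1)) μ₂ z₂) Lc w)))
      (fun κ => ∑' v : Site (3 + 1),
            contourSumAdj (Lc ^ (k + 2)) (fun κ' y => wΦ (N := Lc ^ (k + 2)) κ' μt (y - zt)) κ v
            * (Psi (toSite rr) Lc 0 (k + 1) (delta1 μ₁ z₁) (v + unitVec κ) + PsiFace r (toSite rr) Lc 0 (k + 1) (delta1 μ₁ z₁) (v + unitVec κ) - bmGaugeAt (toSite rr) (respStep (d := 3) 1 (Lc ^ (k + 2)) μ₁ z₁) Lc (v + unitVec κ))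
            * ((Psi (toSite rr) Lc 0 (k + 1) (delta1 μ₂ z₂) (v + unitVec κ) + PsiFace r (toSite rr) Lc 0 (k + 1) (delta1 μ₂ z₂) (v + unitVec κ) - bmGaugeAt (toSite rr) (respStep (d := 3) 1 (Lc ^ (k + 2)) μ₂ z₂) Lc (v + unitVec κ))
              - (Psi (toSite rr) Lc 0 (k + 1) (delta1 μ₂ z₂) v + PsiFace r (toSite rr) Lc 0 (k + 1) (delta1 μ₂ z₂) v - bmGaugeAt (toSite rr) (respStep (d := 3) 1 (Lc ^ (k + 2)) μ₂ z₂) Lc v)))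
      (b := K₄ * ϑ ^ k)
      (fun κ _ => (hPt r hr rr hrr k μt zt μ₁ z₁ μ₂ z₂ κ).trans (geoP hϑ₄0 h4 hK₄ (exp_spread_le_one hκ₄.le _ _) (Real.exp_pos _).le))
    rw [card4] at h
    simpa only [mul_assoc] using h
  have bPm : ∀ (μt : Fin (3 + 1)) (zt : Site (3 + 1)) (μ₁ : Fin (3 + 1)) (z₁ : Site (3 + 1)) (μ₂ : Fin (3 + 1)) (z₂ : Site (3 + 1)),
      |(Lc : ℝ) ^ (12 * (k + 2)) * (∑ κ : Fin (3 + 1), ∑' v : Site (3 + 1),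
            contourSumAdj (Lc ^ (k + 2)) (fun κ' y => wΦ (N := Lc ^ (k + 2)) κ' μt (y - zt)) κ v
            * (((Psi (toSite rr) Lc 0 (k + 1) (delta1 μ₁ z₁) v + PsiFace r (toSite rr) Lc 0 (k + 1) (delta1 μ₁ z₁) v - bmGaugeAt (toSite rr) (respStep (d := 3) 1 (Lc ^ (k + 2)) μ₁ z₁) Lc v)
              + (Psi (toSite rr) Lc 0 (k + 1) (delta1 μ₁ z₁) (v + unitVec κ) + PsiFace r (toSite rr) Lc 0 (k + 1) (delta1 μ₁ z₁) (v + unitVec κ) - bmGaugeAt (toSite rr) (respStep (d := 3) 1 (Lc ^ (k + 2)) μ₁ z₁) Lc (v + unitVec κ))) / 2)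
            * ((Psi (toSite rr) Lc 0 (k + 1) (delta1 μ₂ z₂) (v + unitVec κ) + PsiFace r (toSite rr) Lc 0 (k + 1) (delta1 μ₂ z₂) (v + unitVec κ) - bmGaugeAt (toSite rr) (respStep (d := 3) 1 (Lc ^ (k + 2)) μ₂ z₂) Lc (v + unitVec κ))
              - (Psi (toSite rr) Lc 0 (k + 1) (delta1 μ₂ z₂) v + PsiFace r (toSite rr) Lc 0 (k + 1) (delta1 μ₂ z₂) v - bmGaugeAt (toSite rr) (respStep (d := 3) 1 (Lc ^ (k + 2)) μ₂ z₂) Lc v)))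
          - (Lc : ℝ) ^ (12 * (k + 1)) * (∑ κ : Fin (3 + 1), ∑' w : Site (3 + 1),
            contourSumAdj (Lc ^ (k + 1)) (fun κ' y => wΦ (N := Lc ^ (k + 1)) κ' μt (y - zt)) κ w
            * (((Psi (toSite rr) Lc 0 k (delta1 μ₁ z₁) w + PsiFace r (toSite rr) Lc 0 k (delta1 μ₁ z₁) w - bmGaugeAt (toSite rr) (respStep (d := 3) 1 (Lc ^ (k + 1)) μ₁ z₁) Lc w)
              + (Psi (toSite rr) Lc 0 k (delta1 μ₁ z₁) (w + unitVec κ) + PsiFace r (toSite rr) Lc 0 k (delta1 μ₁ z₁) (w + unitVec κ) - bmGaugeAt (toSite rr) (respStep (d := 3) 1 (Lc ^ (k + 1)) μ₁ z₁) Lc (w + unitVec κ))) / 2)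
            * ((Psi (toSite rr) Lc 0 k (delta1 μ₂ z₂) (w + unitVec κ) + PsiFace r (toSite rr) Lc 0 k (delta1 μ₂ z₂) (w + unitVec κ) - bmGaugeAt (toSite rr) (respStep (d := 3) 1 (Lc ^ (k + 1)) μ₂ z₂) Lc (w + unitVec κ))
              - (Psi (toSite rr) Lc 0 k (delta1 μ₂ z₂) w + PsiFace r (toSite rr) Lc 0 k (delta1 μ₂ z₂) w - bmGaugeAt (toSite rr) (respStep (d := 3) 1 (Lc ^ (k + 1)) μ₂ z₂) Lc w)))|
        ≤ 4 * K₅ * ϑ ^ k := by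
    intro μt zt μ₁ z₁ μ₂ z₂
    have h := abs_mul_sum_sub_le (Finset.univ : Finset (Fin (3 + 1))) ((Lc : ℝ) ^ (12 * (k + 1))) ((Lc : ℝ) ^ (12 * (k + 2)))
      (fun κ => ∑' w : Site (3 + 1),
            contourSumAdj (Lc ^ (k + 1)) (fun κ' y => wΦ (N := Lc ^ (k + 1)) κ' μt (y - zt)) κ w
            * (((Psi (toSite rr) Lc 0 k (delta1 μ₁ z₁) w + PsiFace r (toSite rr) Lc 0 k (delta1 μ₁ z₁) w - bmGaugeAt (toSite rr) (respStep (d := 3) 1 (Lc ^ (k + 1)) μ₁ z₁) Lc w)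
              + (Psi (toSite rr) Lc 0 k (delta1 μ₁ z₁) (w + unitVec κ) + PsiFace r (toSite rr) Lc 0 k (delta1 μ₁ z₁) (w + unitVec κ) - bmGaugeAt (toSite rr) (respStep (d := 3) 1 (Lc ^ (k + 1)) μ₁ z₁) Lc (w + unitVec κ))) / 2)
            * ((Psi (toSite rr) Lc 0 k (delta1 μ₂ z₂) (w + unitVec κ) + PsiFace r (toSite rr) Lc 0 k (delta1 μ₂ z₂) (w + unitVec κ) - bmGaugeAt (toSite rr) (respStep (d := 3) 1 (Lc ^ (k + 1)) μ₂ z₂) Lc (w + unitVec κ))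
              - (Psi (toSite rr) Lc 0 k (delta1 μ₂ z₂) w + PsiFace r (toSite rr) Lc 0 k (delta1 μ₂ z₂) w - bmGaugeAt (toSite rr) (respStep (d := 3) 1 (Lc ^ (k + 1)) μ₂ z₂) Lc w)))
      (fun κ => ∑' v : Site (3 + 1),
            contourSumAdj (Lc ^ (k + 2)) (fun κ' y => wΦ (N := Lc ^ (k + 2)) κ' μt (y - zt)) κ v
            * (((Psi (toSite rr) Lc 0 (k + 1) (delta1 μ₁ z₁) v + PsiFace r (toSite rr) Lc 0 (k + 1) (delta1 μ₁ z₁) v - bmGaugeAt (toSite rr) (respStep (d := 3) 1 (Lc ^ (k + 2)) μ₁ z₁) Lc v)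
              + (Psi (toSite rr) Lc 0 (k + 1) (delta1 μ₁ z₁) (v + unitVec κ) + PsiFace r (toSite rr) Lc 0 (k + 1) (delta1 μ₁ z₁) (v + unitVec κ) - bmGaugeAt (toSite rr) (respStep (d := 3) 1 (Lc ^ (k + 2)) μ₁ z₁) Lc (v + unitVec κ))) / 2)
            * ((Psi (toSite rr) Lc 0 (k + 1) (delta1 μ₂ z₂) (v + unitVec κ) + PsiFace r (toSite rr) Lc 0 (k + 1) (delta1 μ₂ z₂) (v + unitVec κ) - bmGaugeAt (toSite rr) (respStep (d := 3) 1 (Lc ^ (k + 2)) μ₂ z₂) Lc (v + unitVec κ))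
              - (Psi (toSite rr) Lc 0 (k + 1) (delta1 μ₂ z₂) v + PsiFace r (toSite rr) Lc 0 (k + 1) (delta1 μ₂ z₂) v - bmGaugeAt (toSite rr) (respStep (d := 3) 1 (Lc ^ (k + 2)) μ₂ z₂) Lc v)))
      (b := K₅ * ϑ ^ k)
      (fun κ _ => (hPm r hr rr hrr k μt zt μ₁ z₁ μ₂ z₂ κ).trans (geoP hϑ₅0 h5 hK₅ (exp_spread_le_one hκ₅.le _ _) (Real.exp_pos _).le))
    rw [card4] at h
    simpa only [mul_assoc] using h
  -- the two towers as atoms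
  have hc' := contact_eq_atoms hLc hr hrr (k + 1) κ₁' u' x' z' α β
  rw [show k + 1 + 1 = k + 2 from rfl] at hc'
  rw [hc', contact_eq_atoms hLc hr hrr k κ₁' u' x' z' α β]
  refine (abs_comb_le _ _ _ _ _ _ _ _ _ _ _ _ _ _ _ _ _ _ _ _).trans ?_
  have e1 := bT κ₁' u' α x' β z'
  have e2 := bPt β z' α x' κ₁' u'
  have e3 := bM β z' α x' κ₁' u'
  have e4 := bPm κ₁' u' α x' β z'
  have e5 := bT κ₁' u' β z' α x'
  have e6 := bPt α x' β z' κ₁' u'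
  have e7 := bM α x' β z' κ₁' u'
  have e8 := bS β z' κ₁' u' α x'
  have e9 := bS α x' κ₁' u' β z'
  have hsum := add_le_add (add_le_add (add_le_add (add_le_add (add_le_add (add_le_add (add_le_add (add_le_add e1 e2) e3) e4) e5) e6) e7) e8) e9
  refine (mul_le_mul_of_nonneg_left hsum (by norm_num : (0 : ℝ) ≤ 1 / 2)).trans (le_of_eq ?_)
  rw [hK]
  ring

end Three

end Summit.QuantumFields.BalabanUV.Beta.GAN24.CombContactCauchyAssembly

end
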